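import Literature.MathematicalPhysics.QuantumFieldTheory.CubicalChainsPoincare
import HarnessLib

/-!
# Cubical chains on `ℤ^d`: divergences, coboundaries and the Hodge identities `∂∂* + ∂*∂ = -Δ`

Support file for the lattice potential theory of the four-dimensional `U(1)` gauge theory (proof
programme of the named fact
`Literature.MathematicalPhysics.QuantumFieldTheory.FrohlichSpencerU1PerimeterLawD4`;
Fröhlich–Spencer 1982 §2.3 "exterior difference calculus", (2.9)–(2.18): `d`, `δ`, `dd = 0`,
`δδ = 0`, the inner product (2.14) and `-Δ = dδ + δd` used in §2.5, (2.35), and §2.7, (2.50)–(2.51)).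
Everything is proved; no named fact is introduced.

Conventions (those of `CubicalChainsPoincare` and `CubicalCochains`): `k`-tensors
`Site d → (Fin d)^k → A` over an abelian group `A`; the CHAIN boundaries are the backward
divergences `div₂ M y k = ∑ⱼ (M (y - eⱼ) j k - M y j k)`, `div₃`, `div₄` (for `A = ℤ` these are
`LatticeChain.bd₂`, `LatticeChain.bd₃` definitionally: `div₂_eq_bd₂`, `div₃_eq_bd₃`), and the
COCHAIN coboundaries are the forward alternating differences `LatticeForm.d₁`, `LatticeForm.d₂`
of `CubicalCochains` and the new `cd₃` (degree three). With the normalised pairings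
`⟪·,·⟫ₖ = (1/k!) ∑` of alternating tensors, `d_{k-1}` is the adjoint of `divₖ` (the adjointness
over finite supports is not needed here and not proved in this file); the present file proves the
POINTWISE operator identities, valid for all (not necessarily alternating) tensors:

* `div₃_d₂_add_d₁_div₂` (**Hodge identity in degree two**): `div₃ (d₂ M) + d₁ (div₂ M) = negLap₂ M`,
* `div₄_cd₃_add_d₂_div₃` (**Hodge identity in degree three**): `div₄ (cd₃ Q) + d₂ (div₃ Q) = negLap₃ Q`,

where `negLapₖ` is the componentwise lattice Laplacian `(-ΔT)(y) = ∑ⱼ (2T(y) - T(y+eⱼ) - T(y-eⱼ))`,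
together with `cd₃_d₂ = 0` and the generic `div₂_div₃ = 0`, `div₃_div₄ = 0` for alternating
tensors. These are the algebraic inputs of the Coulomb-energy bound `(ε_Λ, ε_Λ) ≤ const (L+T)`
(Fröhlich–Spencer (2.88)): with `u = d₂σ` the walls of the sheet `σ` of a Wilson loop and `v` a
3-chain, `‖div₃ v‖² = ⟪v, d₂ div₃ v⟫ = ⟪v, -Δv⟫ - ‖cd₃ v‖²`-type computations rest on the
degree-three identity, and `σ - div₃(G d₂σ) = d₁ G (div₂ σ)` on the degree-two one.

## References

* J. Fröhlich, T. Spencer, Comm. Math. Phys. 83 (1982) 411–454, §2.3 (2.9)–(2.18), §2.5 (2.35).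
  [FrohlichSpencerCMP1982]
-/

open Finset Function Literature.Probability.LatticeModels

noncomputable section

namespace Literature.MathematicalPhysics.QuantumFieldTheory

namespace LatticeChain

open LatticeForm (e d₁ d₂)

variable {d : ℕ} {A : Type*} [AddCommGroup A]

/-! ### Divergences (chain boundaries) over an abelian group -/

/-- The boundary of a 2-chain with coefficients in `A`: `div₂ M y k = ∑ⱼ (M (y - eⱼ) j k - M y j k)`.
[folklore] -/
def div₂ (M : Site d → Fin d → Fin d → A) : Site d → Fin d → A :=
  fun y k => ∑ j, (M (y - e j) j k - M y j k)

/-- The boundary of a 3-chain with coefficients in `A`. [folklore] -/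
def div₃ (Q : Site d → Fin d → Fin d → Fin d → A) : Site d → Fin d → Fin d → A :=
  fun y k l => ∑ j, (Q (y - e j) j k l - Q y j k l)

/-- The boundary of a 4-chain with coefficients in `A`. [folklore] -/
def div₄ (P : Site d → Fin d → Fin d → Fin d → Fin d → A) : Site d → Fin d → Fin d → Fin d → A :=
  fun y j k l => ∑ i, (P (y - e i) i j k l - P y i j k l)

/-- Over `ℤ`, `div₂` is `bd₂`. [folklore] -/
theorem div₂_eq_bd₂ (M : Site d → Fin d → Fin d → ℤ) : div₂ M = bd₂ M := rfl

/-- Over `ℤ`, `div₃` is `bd₃`. [folklore] -/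
theorem div₃_eq_bd₃ (Q : Site d → Fin d → Fin d → Fin d → ℤ) : div₃ Q = bd₃ Q := rfl

/-- The coboundary of a 3-cochain:
`cd₃ Q (x; i, j, k, l) = ∂ᵢ Q_{jkl} - ∂ⱼ Q_{ikl} + ∂_k Q_{ijl} - ∂_l Q_{ijk}`, `∂ᵢ h(x) = h(x+eᵢ) - h(x)`
(degree-three companion of `LatticeForm.d₀`, `d₁`, `d₂`). [folklore] -/
def cd₃ (Q : Site d → Fin d → Fin d → Fin d → A) : Site d → Fin d → Fin d → Fin d → Fin d → A :=
  fun x i j k l => (Q (x + e i) j k l - Q x j k l) - (Q (x + e j) i k l - Q x i k l) +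
    (Q (x + e k) i j l - Q x i j l) - (Q (x + e l) i j k - Q x i j k)

/-- `cd₃ ∘ d₂ = 0`. [folklore] -/
theorem cd₃_d₂ (ω : Site d → Fin d → Fin d → A) : cd₃ (d₂ ω) = 0 := by
  funext x i j k l
  simp only [cd₃, d₂, Pi.zero_apply]
  rw [add_right_comm x (e i) (e j), add_right_comm x (e i) (e k), add_right_comm x (e i) (e l),
    add_right_comm x (e j) (e k), add_right_comm x (e j) (e l), add_right_comm x (e k) (e l)]
  abel

/-! ### The componentwise lattice Laplacians -/

/-- `-Δ` on 2-tensors, componentwise: `(-ΔM)(y; k, l) = ∑ⱼ (2M(y) - M(y+eⱼ) - M(y-eⱼ))(k, l)`. [folklore] -/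
def negLap₂ (M : Site d → Fin d → Fin d → A) : Site d → Fin d → Fin d → A :=
  fun y k l => ∑ j, ((M y k l - M (y + e j) k l) + (M y k l - M (y - e j) k l))

/-- `-Δ` on 3-tensors, componentwise. [folklore] -/
def negLap₃ (Q : Site d → Fin d → Fin d → Fin d → A) : Site d → Fin d → Fin d → Fin d → A :=
  fun y j k l => ∑ i, ((Q y j k l - Q (y + e i) j k l) + (Q y j k l - Q (y - e i) j k l))

/-! ### The Hodge identities -/

/-- **Hodge identity in degree two**: `div₃ (d₂ M) + d₁ (div₂ M) = -ΔM` for every 2-tensor `M`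
(`∂∂* + ∂*∂ = -Δ` on 2-chains; Fröhlich–Spencer's `-Δ = dδ + δd`). [cite: FrohlichSpencerCMP1982, §2.5 (2.35) with §2.3 (2.13)–(2.16)] -/
theorem div₃_d₂_add_d₁_div₂ (M : Site d → Fin d → Fin d → A) :
    div₃ (d₂ M) + d₁ (div₂ M) = negLap₂ M := by
  funext y k l
  simp only [div₃, div₂, d₂, d₁, negLap₂, Pi.add_apply]
  rw [← Finset.sum_add_distrib, ← Finset.sum_sub_distrib, ← Finset.sum_sub_distrib,
    ← Finset.sum_add_distrib]
  refine Finset.sum_congr rfl fun j _ => ?_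
  have h1 : y - e j + e k = y + e k - e j := by abel
  have h2 : y - e j + e l = y + e l - e j := by abel
  have h3 : y - e j + e j = y := by abel
  rw [h1, h2, h3]
  abel

/-- **Hodge identity in degree three**: `div₄ (cd₃ Q) + d₂ (div₃ Q) = -ΔQ` for every 3-tensor `Q`
(`∂∂* + ∂*∂ = -Δ` on 3-chains). [cite: FrohlichSpencerCMP1982, §2.5 (2.35) with §2.3 (2.13)–(2.16)] -/
theorem div₄_cd₃_add_d₂_div₃ (Q : Site d → Fin d → Fin d → Fin d → A) :
    div₄ (cd₃ Q) + d₂ (div₃ Q) = negLap₃ Q := by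
  funext y j k l
  simp only [div₄, div₃, cd₃, d₂, negLap₃, Pi.add_apply]
  rw [← Finset.sum_sub_distrib, ← Finset.sum_sub_distrib, ← Finset.sum_sub_distrib,
    ← Finset.sum_sub_distrib, ← Finset.sum_add_distrib, ← Finset.sum_add_distrib]
  refine Finset.sum_congr rfl fun i _ => ?_
  have h1 : y - e i + e j = y + e j - e i := by abel
  have h2 : y - e i + e k = y + e k - e i := by abel
  have h3 : y - e i + e l = y + e l - e i := by abel
  have h4 : y - e i + e i = y := by abel
  rw [h1, h2, h3, h4]
  abel

/-! ### `∂∂ = 0` over a torsion-free abelian group -/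

section TorsionFree

variable [IsAddTorsionFree A]

/-- A double sum `∑ⱼ ∑ᵢ T (f i j) i j` with `(i,j)`-symmetric sites `f` vanishes for `T`
antisymmetric in `(i, j)` (torsion-free coefficients). [folklore] -/
theorem sum_sum_eq_zero_of_antisymm (T : Site d → Fin d → Fin d → A)
    (hT : ∀ y i j, T y j i = -T y i j) (f : Fin d → Fin d → Site d) (hf : ∀ i j, f i j = f j i) :
    ∑ j, ∑ i, T (f i j) i j = 0 := by
  have hs : ∑ j, ∑ i, T (f i j) i j = -∑ j, ∑ i, T (f i j) i j := by
    conv_lhs => rw [Finset.sum_comm]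
    simp only [← Finset.sum_neg_distrib]
    refine Finset.sum_congr rfl fun i _ => Finset.sum_congr rfl fun j _ => ?_
    rw [hf j i, hT (f i j) i j, neg_neg]
  exact self_eq_neg.1 hs

/-- **`∂∂ = 0` in degree three**: `div₂ (div₃ Q) = 0` for `Q` antisymmetric in its first two
indices. [cite: FrohlichSpencerCMP1982, §2.3 (2.16)] -/
theorem div₂_div₃ {Q : Site d → Fin d → Fin d → Fin d → A} (h : ∀ y i j k, Q y j i k = -Q y i j k) :
    div₂ (div₃ Q) = 0 := by
  funext y k
  simp only [div₂, div₃, Pi.zero_apply, Finset.sum_sub_distrib]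
  have h1 := sum_sum_eq_zero_of_antisymm (fun z i j => Q z i j k) (fun z i j => h z i j k)
    (fun i j => y - e j - e i) (fun i j => by rw [sub_sub, sub_sub, add_comm])
  have h2 := sum_sum_eq_zero_of_antisymm (fun z i j => Q z i j k) (fun z i j => h z i j k)
    (fun _ _ => y) (fun _ _ => rfl)
  have h3 : ∑ j, ∑ i, Q (y - e j) i j k = -∑ j, ∑ i, Q (y - e i) i j k := by
    conv_lhs => rw [Finset.sum_comm]
    simp only [← Finset.sum_neg_distrib]
    refine Finset.sum_congr rfl fun i _ => Finset.sum_congr rfl fun j _ => ?_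
    rw [h (y - e j) i j k, neg_neg]
  rw [h1, h2, h3]
  abel

/-- **`∂∂ = 0` in degree four**: `div₃ (div₄ P) = 0` for `P` antisymmetric in its first two
indices. [cite: FrohlichSpencerCMP1982, §2.3 (2.16)] -/
theorem div₃_div₄ {P : Site d → Fin d → Fin d → Fin d → Fin d → A}
    (h : ∀ y i j k l, P y j i k l = -P y i j k l) : div₃ (div₄ P) = 0 := by
  funext y k l
  simp only [div₃, div₄, Pi.zero_apply, Finset.sum_sub_distrib]
  have h1 := sum_sum_eq_zero_of_antisymm (fun z i j => P z i j k l) (fun z i j => h z i j k l)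
    (fun i j => y - e j - e i) (fun i j => by rw [sub_sub, sub_sub, add_comm])
  have h2 := sum_sum_eq_zero_of_antisymm (fun z i j => P z i j k l) (fun z i j => h z i j k l)
    (fun _ _ => y) (fun _ _ => rfl)
  have h3 : ∑ j, ∑ i, P (y - e j) i j k l = -∑ j, ∑ i, P (y - e i) i j k l := by
    conv_lhs => rw [Finset.sum_comm]
    simp only [← Finset.sum_neg_distrib]
    refine Finset.sum_congr rfl fun i _ => Finset.sum_congr rfl fun j _ => ?_
    rw [h (y - e j) i j k l, neg_neg]
  rw [h1, h2, h3]
  abel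

end TorsionFree

end LatticeChain

end Literature.MathematicalPhysics.QuantumFieldTheory
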